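import Mathlib

/-!
# Width-1 word decay `WD₁` — the statement `stub_lowCutKatai` is blocked on at `R₀ = 2` (crux workfile, statements only)

Crux `MobiusLadder.QuadraticDigitPhases` (stmt-QuantumAdvantage-1391), line `Sketch`, LOW-cut branch.  This file only FIXES
STATEMENTS (it elaborates; the one theorem is `sorry`): the 16-letter width-1 transfer alphabet of the worker report
`R0eq2.md` (evidence on the item) and the word-decay statement `WD₁(p,q)` to which `stub_lowCutKatai` restricted to `R₀ ≤ 2`
is equivalent (R0eq2.md §2).  It is meant as the planner's starting point for promoting `stub_lowCutKatai` to its own item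
("inhomogeneous bounded-width Kátai decay"); width `r` (for `R₀ = r + 1`) replaces the two fibre bits by `Fin r → Bool` and the
letters by `(u v : Fin r → Bool) × (Φ : Matrix (Fin r) (Fin r) Bool) × Bool`.

States `(c, c', S, S') : Fin p × Fin q × Bool × Bool` (the two carries of `m ↦ (pm, qm)` and the two fibre bits = current value of
the pending linear form on the digits of `pm`, resp. `qm`).  A letter `ℓ = (src, snk, keep, lin) : Bool⁴` is the local datum of a
cut-rank-≤-1 quadratic `P_w = Σ_j x_j (snk_j S_j + lin_j)`, `S_{j+1} = keep_j S_j + src_j x_j` (quasiseparable generators of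
order 1: `x_i x_j ∈ P ⇔ src_i ∧ snk_j ∧ ∀ i<l<j, keep_l`).  Reading the input bit `t` at carry `(c,c')` outputs
`y = (pt + c) mod 2`, `z = (qt + c') mod 2`, moves the carries to `(⌊(pt+c)/2⌋, ⌊(qt+c')/2⌋)`, the fibres to
`(keep ∧ S) ⊕ (src ∧ y), (keep ∧ S') ⊕ (src ∧ z)`, and contributes the sign `(-1)^{y (snk S + lin) + z (snk S' + lin)}`, weight `½`.
Then `2^{-n} Σ_{m<2^n} χ_{P_w}(pm) χ_{P_w}(qm) = e_{(0,0,0,0)} T_{w₀} ⋯ T_{w_{n-1}} 𝟙` (R0eq2.md §2.2, validated numerically).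

`farChain s w` is the greedy number of disjoint FAR UNITS (a sink reading a live source more than `s` digits older; R0eq2.md
§2.3: `ρ_s(A_w) ≤ 2 · farChain s w`, so "not `(R,s)`-low" gives `farChain s w ≥ R`).
-/

set_option linter.dupNamespace false -- D-0017: single-problem summit ⇒ `QuantumAdvantage.QuantumAdvantage` by design

namespace Summit.QuantumAdvantage.QuantumAdvantage.Cruxes.QuadraticDigitPhases.WD1

open Finset

/-- Greedy far-unit count of a width-1 word, scanning positions `j = 0, 1, …` with the earliest live source `e` since the
last unit: at position `j` with letter `(src, snk, keep, lin)` — (1) if `snk` and `e = some i` with `j - i > s`, a unit fires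
and `e` is reset; (2) if `¬ keep`, every source `< j` dies (`e := none`); (3) if `src` and no source is live, `e := some j`. -/
def farChainAux (s : ℕ) : List (Bool × Bool × Bool × Bool) → ℕ → Option ℕ → ℕ
  | [], _, _ => 0
  | (src, snk, keep, _) :: w, j, e =>
    let fired : Bool := snk && (match e with | some i => decide (s < j - i) | none => false)
    let e₁ : Option ℕ := if fired then none else e
    let e₂ : Option ℕ := if keep then e₁ else none
    let e₃ : Option ℕ := match e₂ with | some i => some i | none => if src then some j else none
    (if fired then 1 else 0) + farChainAux s w (j + 1) e₃

/-- `farChain s w`: greedy number of disjoint far units (span `> s`) of the width-1 word `w`. -/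
def farChain (s : ℕ) (w : List (Bool × Bool × Bool × Bool)) : ℕ := farChainAux s w 0 none

/-- The width-1 transfer letter `T_ℓ` on `Fin p × Fin q × Bool × Bool` (see the module docstring). -/
noncomputable def letter (p q : ℕ) (ℓ : Bool × Bool × Bool × Bool) :
    Matrix (Fin p × Fin q × Bool × Bool) (Fin p × Fin q × Bool × Bool) ℝ :=
  Matrix.of fun x x' =>
    ∑ t ∈ ({0, 1} : Finset ℕ),
      if (x'.1 : ℕ) = (p * t + x.1) / 2 ∧ (x'.2.1 : ℕ) = (q * t + x.2.1) / 2 ∧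
          x'.2.2.1 = ((ℓ.2.2.1 && x.2.2.1) ^^ (ℓ.1 && decide ((p * t + x.1) % 2 = 1))) ∧
          x'.2.2.2 = ((ℓ.2.2.1 && x.2.2.2) ^^ (ℓ.1 && decide ((q * t + x.2.1) % 2 = 1)))
      then (1 / 2 : ℝ) *
        (-1 : ℝ) ^ (((p * t + x.1) % 2) * ((if ℓ.2.1 && x.2.2.1 then 1 else 0) + (if ℓ.2.2.2 then 1 else 0))) *
        (-1 : ℝ) ^ (((q * t + x.2.1) % 2) * ((if ℓ.2.1 && x.2.2.2 then 1 else 0) + (if ℓ.2.2.2 then 1 else 0)))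
      else 0

/-- `WD₁(p,q)` (ℓ¹ form, sufficient for `stub_lowCutKatai` at `R₀ ≤ 2`, R0eq2.md §2.4): for all distinct odd primes `p, q`
and every `δ > 0` there are `w, s` such that every width-1 word with at least `w` disjoint far units of span `> s` maps the
basis row vector at `(0,0,0,0)` to a row vector of `ℓ¹`-norm `≤ δ`.  OPEN (numerically supported: R0eq2.md §4). -/
theorem WD₁_statement :
    ∀ p q : ℕ, ∀ hp : p.Prime, ∀ hq : q.Prime, p ≠ q → 2 < p → 2 < q →
      ∀ δ : ℝ, 0 < δ → ∃ w s : ℕ, ∀ word : List (Bool × Bool × Bool × Bool), w ≤ farChain s word →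
        ∑ y : Fin p × Fin q × Bool × Bool,
          |((word.map (letter p q)).prod) ((⟨0, hp.pos⟩, ⟨0, hq.pos⟩, false, false)) y| ≤ δ := by
  sorry

end Summit.QuantumAdvantage.QuantumAdvantage.Cruxes.QuadraticDigitPhases.WD1
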